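import Literature.MathematicalPhysics.QuantumFieldTheory.BalabanImbrieJaffe1984to88.BIJ88Eq5145HeadMultiCubeSlots
import Literature.MathematicalPhysics.QuantumFieldTheory.BalabanImbrieJaffe1984to88.BIJ88SlotFieldGaussBounds

/-!
# `BalabanImbrieJaffe1984to88.BIJ88Ineq5144LocatedSlots` — T. Bałaban, J. Imbrie, A. Jaffe, *Effective action and cluster properties of the abelian
Higgs model*, Commun. Math. Phys. **114** (1988) 257–315 [BalabanImbrieJaffe1988], Sect. 5.14, (5.14.4) p. 309 [PDF 53]: **THE TYPED LEAF (5.14.4)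
BY NAME, IN PRINT'S LOCATED READING, FOR BLOCK-DIAGONAL PRECISIONS WITH THE FULL p. 308 SLOT DATA.**

statement-level skeleton of published theorems with citation tags; proofs where landed; nothing here is a claim about the Yang–Mills mass gap

p. 309, verbatim: *"Let us drop the prime, and prove that |g₃(H_β, X_β)| ≤ (e^β(L^kε/ε₀)^{1/4−α})^{[|H_β| + β′|X_β∖H_β|]}. (5.14.4) … Here H_β ⊂ H
specifies which (d/dt)_{γ_j} have supports intersecting X_β."*  r16's typed leaf `BIJ88Sect5StatementsPart2.Ineq5144` in the located reading of
p36 gen 14 (`BIJ88Ineq5144Located.locAct`: a pair `(H, X″)` is evaluated only when every derivative of `H` sits in a cube of `X″`) is the exact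
hypothesis shape `Ineq5144 (cubeSys I) (Finset L) (locAct (cubeIn ∘ γ) (actIn … X t γ)) card (H X″ ↦ |X″ ∖ loc H|) θ β′` of the gen-14 head
`BIJ88Eq5145CornerW6Loc.eq5145_zG_mod_W6v_of_ineq5144_loc`.

WHAT IS PROVED (unit `lit-balaban-p36`, generation 16 of the Phase-2 proof seat p36; SKELETON row **C2.Eq5.14.3-5.14.4** member cell of
`HOME/lit-balaban-r16/ROWS-C2-part2.md`, owner r16).  Gen 14's `BIJ88Ineq5144LocatedWitness.ineq5144_locAct_witness` inhabited the located leaf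
on DEGENERATE data (no χ-slots, a constant interaction); this file inhabits it for block-diagonal `Δ ≻ 0` (no inter-cube coupling) with the FULL
slot data of p. 308 — χ-slots `χ(c_b p(te_k), Φ_b)` with sub-Gaussian one-cube laws, bounded measurable terms `V(Y)` — in the `e_k`-small regime:
§1 `actIn_empty_right` (the empty polymer carries no activity: p27's `g1_empty`); §2 **`ineq5144_locAct_blockDiag_of_tail`**: the three cases
`|X″| = 0` (§1), `|X″| = 1` (p36 gen 15's `BIJ88Ineq5144OneCube.ineq5144_locAct_singleton_of_const`: the genuine one-cube estimates, p. 309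
*"The bound for H_β = ∅, |X_β| = 1 was obtained for g₂, and the same proof applies here"*), `|X″| ≥ 2` (p36 gen 16's
`BIJ88Eq5145HeadMultiCubeSlots.abs_locAct_actIn_le_of_two_le`: for block-diagonal `Δ` the activity vanishes); §3 **`ineq5144_locAct_blockDiag_of_struct`**:
the same with the tail input from structural data (`Δ ≥ m·1`, `|ℓ_j φ| ≤ Λ‖φ‖₂`, `‖ℱ|_□‖₂ ≤ F`; gen 16's
`BIJ88SlotFieldGaussBounds.ineq5144_locAct_singleton_of_struct`); §4 **`ineq5144_locAct_blockDiag_instance_uniform`** — KERNEL CERTIFICATE WITH A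
UNIFORM THRESHOLD: for `p > 1/2` and `n₀` there is `e₀(p, n₀) > 0` such that for EVERY finite cube set `I`, abutting relation, cube map `inl b ↦ b`,
`e_k ∈ (0, e₀)`, corner, region, `t ∈ (0,1]`, label type `|L| ≤ n₀` and assignment, the data «sites = cubes, `Δ = 1`, `ℱ = 0`, one linear χ-slot
per cube, `c ≡ 1`, no terms, `χ = gevreyCutoff`» satisfy the leaf BY NAME with `θ = √e_k`, `β′ = 1`.
HONEST SCOPE: CERTIFICATE-LEVEL — print's `Δ` couples abutting cubes, and for coupled `Δ` the multi-cube polymers (the inductive cluster-expansion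
decay, p. 309 *"The proof of this estimate is similar to the one for g₂"*) are NOT treated anywhere in the tree; the head of row C2.Eq5.14.3-5.14.4
stays typed.  0 `sorry`, 0 definitions, 0 `Prop` facts (D-0026); imports `BIJ88Eq5145HeadMultiCubeSlots`, `BIJ88SlotFieldGaussBounds` (p36 g16);
modifies nothing.  NOT summit progress; NOT continuum; NOT Clay.  Cell `lit-balaban` Phase 2, seat p36 gen 16 (owner r16, referee ref-5).
-/

noncomputable section

open Finset MeasureTheory ProbabilityTheory Matrix Filter
open Literature.MathematicalPhysics.QuantumFieldTheory.BalabanImbrieJaffe1984to88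
open BIJ88Sect2Statements (pLog)
open BIJ88Sect5Statements (CutoffProfile cutoff)
open BIJ88Sect5StatementsPart2 (Ineq5144)
open BIJ88Ineq5113Covering (cubeSys)
open BIJ88PolymerRep5134 (g1 g1_empty)
open BIJ88PolymerRep5134Gauss (ext src)
open BIJ88Expansion5143 (g3 prime prime_of_not)
open BIJ88SlotMomentsGauss308 (fieldLaw)
open BIJ88Eq5145CornerModel (slotB slotY)
open BIJ88Eq5145CornerUrsell (cubeIn)
open BIJ88W6PrimeVsupp (actIn)
open BIJ88Ineq5144Located (locAct locAct_eq_zero_of_eq_zero)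
open BIJ88Ineq5144OneCube (ineq5144_locAct_singleton_of_const)
open BIJ88SlotFieldGaussBounds (ineq5144_locAct_singleton_of_struct)
open BIJ88Eq5145HeadMultiCubeSlots (abs_locAct_actIn_le_of_two_le)
open BIJ88GaussIntegration309Product (exists_const_all_orders)
open BIJ88CutoffProfileWitness (gevreyCutoff chi1_nonneg)
open BIJ88SmallChargeRegime (exists_threshold eventually_const_le_mul_log_rpow eventually_const_mul_le_one eventually_le_one)

namespace Literature.MathematicalPhysics.QuantumFieldTheory.BalabanImbrieJaffe1984to88.BIJ88Ineq5144LocatedSlots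

section Model

variable {α I : Type} [Fintype α] [DecidableEq α] [Fintype I] [DecidableEq I]
  (blk : α → I) (Δ : Matrix α α ℝ) (ℱ : α → ℝ)
variable (adj : I → I → Prop) [DecidableRel adj]
variable (χ : CutoffProfile) {ι υ : Type*} [DecidableEq ι] [DecidableEq υ]
variable {p ek : ℝ} {B : Finset ι} {Φ : ι → (α → ℝ) → ℝ} {c : ι → ℝ} {Ys : Finset υ} {V : υ → (α → ℝ) → ℝ}
variable (cube : ↥B ⊕ ↥Ys → I)

/-! ## §1 The empty polymer carries no activity -/

/-- the prime-dropped activity of the empty cube set is `0` (p27's `g1_empty`: no cluster lives on no cube; the prime only touches one-cube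
polymers). [cite: BalabanImbrieJaffe1988, (5.13.5) p.306; p.309 (Sect. 5.14)] -/
theorem actIn_empty_right (Λ X : Finset I) (t : ℝ) {L : Type*} [DecidableEq L] (γ : L → ↥(slotB B Ys cube X) ⊕ ↥(slotY B Ys cube X))
    (H : Finset L) : actIn blk Δ ℱ adj χ p ek B Φ c Ys V cube Λ X t γ H ∅ = 0 := by
  simp only [actIn]
  rw [prime_of_not _ (fun h => absurd h.2 (by simp)), g3, g1_empty]

/-! ## §2 The located leaf by name for block-diagonal precisions (law-level tails) -/

/-- **(5.14.4) BY NAME, LOCATED READING, BLOCK-DIAGONAL `Δ`, FULL SLOT DATA** (p. 309: *"|g₃(H_β, X_β)| ≤ (e^β(L^kε/ε₀)^{1/4−α})^{[|H_β| +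
β′|X_β∖H_β|]} (5.14.4) … Here H_β ⊂ H specifies which (d/dt)_{γ_j} have supports intersecting X_β. … The bound for H_β = ∅, |X_β| = 1 was obtained
for g₂, and the same proof applies here"*): for the §5.13 data with a block-diagonal positive-definite precision (`Δ_{xy} = 0` across cubes), `χ ≥ 0`,
thresholds `c_b ≥ c₀ > 0`, measurable slot fields with one-cube sub-Gaussian tails `law(□_i){a ≤ |Φ_b|} ≤ A e^{−κa²}`, measurable terms
`|V(Y)| ≤ K_Y ≤ K₁`, `≤ G` slots per cube, the all-orders derivative constant `Ĉ` of the profile for orders `≤ n₀`, `0 < e_k ≤ e⁻¹`, and the regime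
`e_k ≤ θ` · `n₀ + 1 ≤ κ(81/100)c₀²|log e_k⁻¹|^{2p−1}` · `Ĉ^{n₀}Ae^{GK₁}e_k ≤ 1` · `K_Y e^{GK₁} ≤ θ` · `e^{GK₁}GAe_k + (e^{GK₁} − 1) ≤ θ^{β′}`: for every
corner `Λ`, region `X`, `t ∈ (0,1]`, label type `|L| ≤ n₀` and assignment `γ`, r16's typed leaf holds BY NAME for the located activities —
`Ineq5144 (cubeSys I) (Finset L) (locAct (cubeIn ∘ γ) (actIn … Λ X t γ)) card (H X″ ↦ |X″ ∖ loc H|) θ β′`.  Cases: `X″ = ∅` (§1), `|X″| = 1`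
(gen 15's one-cube theorem), `|X″| ≥ 2` (the activity vanishes for block-diagonal `Δ`).  CERTIFICATE-LEVEL: print's `Δ` couples abutting cubes.
[cite: BalabanImbrieJaffe1988, (5.14.4) p.309; (5.13.3) p.305] -/
theorem ineq5144_locAct_blockDiag_of_tail [Fintype ι] [Fintype υ] (hp : 1 / 2 < p) {n₀ : ℕ} {C : ℝ} (hC1 : 1 ≤ C)
    (hC : ∀ i, i ≤ n₀ → ∀ (A : ℝ) ⦃q e t : ℝ⦄, q ≠ 0 → 0 < e → 0 < t → t * e ≤ Real.exp (-1) →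
      |iteratedDeriv i (fun s => cutoff χ (q * pLog p (s * e)) A) t| ≤ C * t ^ (-(i : ℤ)))
    (hΔ0 : ∀ x y, blk x ≠ blk y → Δ x y = 0) (hΔ : Δ.PosDef) (hχ : ∀ x, 0 ≤ χ.χ₁ x) {c₀ : ℝ} (hc₀ : 0 < c₀) (hcb : ∀ b ∈ B, c₀ ≤ c b)
    (hΦm : ∀ b ∈ B, Measurable (Φ b)) (hV : ∀ Y ∈ Ys, Measurable (V Y)) {KY : υ → ℝ} (hK : ∀ Y ∈ Ys, ∀ φ, |V Y φ| ≤ KY Y)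
    {K₁ : ℝ} (hK₁0 : 0 ≤ K₁) (hK₁ : ∀ Y ∈ Ys, KY Y ≤ K₁) {G : ℕ} (hG : ∀ i, (univ.filter fun τ : ↥B ⊕ ↥Ys => cube τ = i).card ≤ G)
    {A κ : ℝ} (hA : 0 ≤ A) (hκ : 0 ≤ κ)
    (htail : ∀ (i : I) (b : ↥B), cube (Sum.inl b) = i → ∀ a : ℝ, 0 ≤ a →
      (fieldLaw blk Δ ℱ {i}).real {ω | a ≤ |Φ b (ext blk {i} ω)|} ≤ A * Real.exp (-(κ * a ^ 2)))
    (hek : 0 < ek) (hek1 : ek ≤ Real.exp (-1)) {θ β' : ℝ} (hekθ : ek ≤ θ)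
    (hreg : (n₀ : ℝ) + 1 ≤ κ * (81 / 100) * c₀ ^ 2 * Real.log ek⁻¹ ^ (2 * p - 1))
    (hpre : C ^ n₀ * A * Real.exp (G * K₁) * ek ≤ 1) (hKθ : ∀ Y ∈ Ys, KY Y * Real.exp (G * K₁) ≤ θ)
    (hvac : Real.exp (G * K₁) * G * A * ek + (Real.exp (G * K₁) - 1) ≤ θ ^ β')
    (Λ X : Finset I) {t : ℝ} (ht : t ∈ Set.Ioc (0 : ℝ) 1) {L : Type} [Fintype L] [DecidableEq L] (hL : Fintype.card L ≤ n₀)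
    (γ : L → ↥(slotB B Ys cube X) ⊕ ↥(slotY B Ys cube X)) :
    Ineq5144 (cubeSys I) (Finset L) (locAct (cubeIn cube X ∘ γ) (actIn blk Δ ℱ adj χ p ek B Φ c Ys V cube Λ X t γ))
      Finset.card (fun H (X'' : Finset I) => (X'' \ H.image (cubeIn cube X ∘ γ)).card) θ β' := by
  rintro H (X'' : Finset I)
  have hθ0 : 0 < θ := hek.trans_le hekθ
  rcases Nat.lt_trichotomy X''.card 1 with hlt | h1 | hgt
  · -- no cube: the activity is `0`
    rw [card_eq_zero.1 (show X''.card = 0 by omega), locAct_eq_zero_of_eq_zero (actIn_empty_right blk Δ ℱ adj χ cube Λ X t γ H),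
      abs_zero]
    exact Real.rpow_nonneg hθ0.le _
  · -- one cube: gen 15's one-cube estimates
    exact ineq5144_locAct_singleton_of_const blk Δ ℱ adj χ cube hp hC1 hC hΔ hχ hc₀ hcb hΦm hV hK hK₁0 hK₁ hG hA hκ htail hek hek1 hekθ
      hreg hpre hKθ hvac Λ X ht hL γ H X'' h1
  · -- at least two cubes: the activity vanishes for block-diagonal `Δ`
    exact abs_locAct_actIn_le_of_two_le blk ℱ adj χ _ _ _ _ _ _ _ cube hΔ0 hθ0 β' Λ X t γ H X'' (by omega)

/-! ## §3 The same with the tail input from structural data -/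

/-- **(5.14.4) BY NAME, LOCATED READING, BLOCK-DIAGONAL `Δ` — TAILS FROM STRUCTURAL DATA**: §2 with `hΦm`, `hA`, `hκ`, `htail` REPLACED by
`Δ ≥ m·1` as a form (`m > 0`), every χ-slot field linear `ℓ₁` or a modulus `√(ℓ₁² + ℓ₂²)` with `|ℓ_j φ| ≤ Λ‖φ‖₂` (`Λ > 0`; p. 308:
`(I − Q_s*Q)A^{(k)}`, `φ^{(k)}`), `‖ℱ|_□‖₂ ≤ F` on every cube (p. 307: *"here we use the fact that the translation vanishes"* is `F = 0`); the tail
constants become `A = 4e^{F²/(2m)}`, `κ = m/(8Λ²)` (gen 16's `BIJ88SlotFieldGaussBounds.ineq5144_locAct_singleton_of_struct`).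
[cite: BalabanImbrieJaffe1988, (5.14.4) p.309; p.307 (Sect. 5.13); (5.13.3) p.305] -/
theorem ineq5144_locAct_blockDiag_of_struct [Fintype ι] [Fintype υ] (hp : 1 / 2 < p) {n₀ : ℕ} {C : ℝ} (hC1 : 1 ≤ C)
    (hC : ∀ i, i ≤ n₀ → ∀ (A : ℝ) ⦃q e t : ℝ⦄, q ≠ 0 → 0 < e → 0 < t → t * e ≤ Real.exp (-1) →
      |iteratedDeriv i (fun s => cutoff χ (q * pLog p (s * e)) A) t| ≤ C * t ^ (-(i : ℤ)))
    (hΔ0 : ∀ x y, blk x ≠ blk y → Δ x y = 0) (hΔ : Δ.PosDef) {m : ℝ} (hm : 0 < m) (hΔm : ∀ φ : α → ℝ, m * (φ ⬝ᵥ φ) ≤ φ ⬝ᵥ (Δ *ᵥ φ))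
    (hχ : ∀ x, 0 ≤ χ.χ₁ x) {c₀ : ℝ} (hc₀ : 0 < c₀) (hcb : ∀ b ∈ B, c₀ ≤ c b) {Λ : ℝ} (hΛ : 0 < Λ)
    (hmod : ∀ b ∈ B, ∃ ℓ₁ ℓ₂ : (α → ℝ) → ℝ, IsLinearMap ℝ ℓ₁ ∧ IsLinearMap ℝ ℓ₂ ∧
      ((∀ φ, Φ b φ = ℓ₁ φ) ∨ (∀ φ, Φ b φ = Real.sqrt (ℓ₁ φ ^ 2 + ℓ₂ φ ^ 2))) ∧
      (∀ φ, |ℓ₁ φ| ≤ Λ * Real.sqrt (φ ⬝ᵥ φ)) ∧ (∀ φ, |ℓ₂ φ| ≤ Λ * Real.sqrt (φ ⬝ᵥ φ)))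
    {F : ℝ} (hF0 : 0 ≤ F) (hF : ∀ i : I, src blk ℱ {i} ⬝ᵥ src blk ℱ {i} ≤ F ^ 2)
    (hV : ∀ Y ∈ Ys, Measurable (V Y)) {KY : υ → ℝ} (hK : ∀ Y ∈ Ys, ∀ φ, |V Y φ| ≤ KY Y)
    {K₁ : ℝ} (hK₁0 : 0 ≤ K₁) (hK₁ : ∀ Y ∈ Ys, KY Y ≤ K₁) {G : ℕ} (hG : ∀ i, (univ.filter fun τ : ↥B ⊕ ↥Ys => cube τ = i).card ≤ G)
    (hek : 0 < ek) (hek1 : ek ≤ Real.exp (-1)) {θ β' : ℝ} (hekθ : ek ≤ θ)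
    (hreg : (n₀ : ℝ) + 1 ≤ m / (8 * Λ ^ 2) * (81 / 100) * c₀ ^ 2 * Real.log ek⁻¹ ^ (2 * p - 1))
    (hpre : C ^ n₀ * (4 * Real.exp (F ^ 2 / (2 * m))) * Real.exp (G * K₁) * ek ≤ 1) (hKθ : ∀ Y ∈ Ys, KY Y * Real.exp (G * K₁) ≤ θ)
    (hvac : Real.exp (G * K₁) * G * (4 * Real.exp (F ^ 2 / (2 * m))) * ek + (Real.exp (G * K₁) - 1) ≤ θ ^ β')
    (Λ' X : Finset I) {t : ℝ} (ht : t ∈ Set.Ioc (0 : ℝ) 1) {L : Type} [Fintype L] [DecidableEq L] (hL : Fintype.card L ≤ n₀)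
    (γ : L → ↥(slotB B Ys cube X) ⊕ ↥(slotY B Ys cube X)) :
    Ineq5144 (cubeSys I) (Finset L) (locAct (cubeIn cube X ∘ γ) (actIn blk Δ ℱ adj χ p ek B Φ c Ys V cube Λ' X t γ))
      Finset.card (fun H (X'' : Finset I) => (X'' \ H.image (cubeIn cube X ∘ γ)).card) θ β' := by
  rintro H (X'' : Finset I)
  have hθ0 : 0 < θ := hek.trans_le hekθ
  rcases Nat.lt_trichotomy X''.card 1 with hlt | h1 | hgt
  · rw [card_eq_zero.1 (show X''.card = 0 by omega), locAct_eq_zero_of_eq_zero (actIn_empty_right blk Δ ℱ adj χ cube Λ' X t γ H),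
      abs_zero]
    exact Real.rpow_nonneg hθ0.le _
  · exact ineq5144_locAct_singleton_of_struct blk Δ ℱ adj χ cube hp hC1 hC hΔ hm hΔm hχ hc₀ hcb hΛ hmod hF0 hF hV hK hK₁0 hK₁ hG hek
      hek1 hekθ hreg hpre hKθ hvac Λ' X ht hL γ H X'' h1
  · exact abs_locAct_actIn_le_of_two_le blk ℱ adj χ _ _ _ _ _ _ _ cube hΔ0 hθ0 β' Λ' X t γ H X'' (by omega)

end Model

/-! ## §4 A kernel certificate with a uniform threshold `e₀(p, n₀)` -/

/-- **KERNEL CERTIFICATE OF §3 WITH A THRESHOLD CHOSEN BEFORE THE DATUM**: for `p > 1/2` and `n₀` there is `e₀ > 0` such that for every finite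
cube set `I`, every abutting relation, every cube map of the form `Sum.inl b ↦ b`, every `e_k ∈ (0, e₀)`, every corner `Λ`, region `X`,
`t ∈ (0,1]`, label type `|L| ≤ n₀` and assignment `γ`, the data «sites = cubes, `Δ = 1`, `ℱ = 0`, one linear χ-slot per cube (the site field),
`c ≡ 1`, no interaction terms, `χ = gevreyCutoff`» satisfy the typed leaf BY NAME in the located reading with `θ = √e_k`, `β′ = 1` — every
hypothesis of §3 discharged (`m = Λ = 1`, `F = 0`, `G = 1`, `K₁ = 0`, `c₀ = 1`, the all-orders constant `Ĉ(gevreyCutoff, p, n₀)`).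
[cite: BalabanImbrieJaffe1988, (5.14.4) p.309] -/
theorem ineq5144_locAct_blockDiag_instance_uniform {p : ℝ} (hp : 1 / 2 < p) (n₀ : ℕ) :
    ∃ e₀ : ℝ, 0 < e₀ ∧ ∀ {I : Type} [Fintype I] [DecidableEq I] (adj : I → I → Prop) [DecidableRel adj]
      {cube : ↥(univ : Finset I) ⊕ ↥(∅ : Finset I) → I} (_ : ∀ b, cube (Sum.inl b) = b.1) ⦃e : ℝ⦄, 0 < e → e < e₀ →
      ∀ (Λ X : Finset I) {t : ℝ} (_ : t ∈ Set.Ioc (0 : ℝ) 1) {L : Type} [Fintype L] [DecidableEq L] (_ : Fintype.card L ≤ n₀)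
        (γ : L → ↥(slotB (univ : Finset I) (∅ : Finset I) cube X) ⊕ ↥(slotY (univ : Finset I) (∅ : Finset I) cube X)),
        Ineq5144 (cubeSys I) (Finset L)
          (locAct (cubeIn cube X ∘ γ)
            (actIn (id : I → I) (1 : Matrix I I ℝ) (0 : I → ℝ) adj gevreyCutoff p e (univ : Finset I) (fun (i : I) (φ : I → ℝ) => φ i)
              (fun _ => (1 : ℝ)) (∅ : Finset I) (fun (_ : I) (_ : I → ℝ) => (0 : ℝ)) cube Λ X t γ))
          Finset.card (fun H (X'' : Finset I) => (X'' \ H.image (cubeIn cube X ∘ γ)).card) (Real.sqrt e) 1 := by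
  classical
  obtain ⟨C, hC1, hC⟩ := exists_const_all_orders gevreyCutoff p n₀
  have hκ0 : 0 < 1 / (8 * (1 : ℝ) ^ 2) * (81 / 100) * (1 : ℝ) ^ 2 := by positivity
  -- the `e_k`-small regime: five conditions eventually, the threshold BEFORE the datum
  obtain ⟨δ, hδ, hreg⟩ := exists_threshold (Q := fun x : ℝ =>
      ((n₀ : ℝ) + 1 ≤ 1 / (8 * (1 : ℝ) ^ 2) * (81 / 100) * (1 : ℝ) ^ 2 * Real.log x⁻¹ ^ (2 * p - 1)) ∧ Real.exp 1 * x ≤ 1 ∧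
        C ^ n₀ * 4 * x ≤ 1 ∧ 16 * x ≤ 1 ∧ x ≤ 1) (by
    filter_upwards [eventually_const_le_mul_log_rpow ((n₀ : ℝ) + 1) _ (2 * p - 1) hκ0 (by linarith),
      eventually_const_mul_le_one (Real.exp 1), eventually_const_mul_le_one (C ^ n₀ * 4), eventually_const_mul_le_one 16,
      eventually_le_one] with x h1 h2 h3 h4 h5
    exact ⟨h1, h2, h3, h4, h5⟩)
  refine ⟨δ, hδ, ?_⟩
  intro I _ _ adj _ cube hcube e he heδ Λ X t ht L _ _ hL γ
  obtain ⟨h1, h2, h3, h4, h5⟩ := hreg e he heδ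
  -- elementary consequences of the regime
  have he1 : e ≤ Real.exp (-1) := by
    have hpos := Real.exp_pos 1
    calc e = Real.exp 1 * e / Real.exp 1 := by field_simp
      _ ≤ 1 / Real.exp 1 := by gcongr
      _ = Real.exp (-1) := by rw [Real.exp_neg, one_div]
  have hsq1 : Real.sqrt e ≤ 1 := by rw [← Real.sqrt_one]; exact Real.sqrt_le_sqrt h5
  have hsqrt : e ≤ Real.sqrt e := by
    calc e = Real.sqrt e * Real.sqrt e := (Real.mul_self_sqrt he.le).symm
      _ ≤ Real.sqrt e * 1 := by gcongr
      _ = Real.sqrt e := mul_one _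
  have hsq4 : Real.sqrt e ≤ 1 / 4 := by
    have h16 : e ≤ (1 / 4) ^ 2 := by nlinarith
    calc Real.sqrt e ≤ Real.sqrt ((1 / 4) ^ 2) := Real.sqrt_le_sqrt h16
      _ = 1 / 4 := Real.sqrt_sq (by norm_num)
  -- the structural data: `Δ = 1 ≥ 1·1`, slot fields = coordinates (`Λ = 1`), `ℱ = 0` (`F = 0`), one slot per cube
  have hΔm : ∀ φ : I → ℝ, 1 * (φ ⬝ᵥ φ) ≤ φ ⬝ᵥ ((1 : Matrix I I ℝ) *ᵥ φ) := fun φ => by rw [Matrix.one_mulVec, one_mul]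
  have hlin : ∀ i : I, IsLinearMap ℝ (fun φ : I → ℝ => φ i) := fun i => (LinearMap.proj (R := ℝ) (φ := fun _ : I => ℝ) i).isLinear
  have hΛ : ∀ (i : I) (φ : I → ℝ), |φ i| ≤ 1 * Real.sqrt (φ ⬝ᵥ φ) := fun i φ => by
    rw [one_mul]
    refine Real.abs_le_sqrt ?_
    rw [pow_two]
    exact Finset.single_le_sum (f := fun j => φ j * φ j) (fun j _ => mul_self_nonneg (φ j)) (mem_univ i)
  have hF : ∀ i : I, src (id : I → I) (0 : I → ℝ) {i} ⬝ᵥ src (id : I → I) (0 : I → ℝ) {i} ≤ (0 : ℝ) ^ 2 := fun i => by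
    simp [BIJ88PolymerRep5134Gauss.src, dotProduct]
  have hG : ∀ i : I, (univ.filter fun τ : ↥(univ : Finset I) ⊕ ↥(∅ : Finset I) => cube τ = i).card ≤ 1 := fun i =>
    card_le_one.2 fun a ha b hb => by
      obtain ⟨-, ha⟩ := mem_filter.1 ha
      obtain ⟨-, hb⟩ := mem_filter.1 hb
      rcases a with a | a
      · rcases b with b | b
        · rw [hcube] at ha hb
          rw [Subtype.ext (ha.trans hb.symm)]
        · exact absurd b.2 (notMem_empty _)
      · exact absurd a.2 (notMem_empty _)
  -- the regime inequalities in the shape of §3 (`G = 1`, `K₁ = 0`, `m = Λ = 1`, `F = 0`, `θ = √e_k`, `β′ = 1`)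
  have hpre : C ^ n₀ * (4 * Real.exp ((0 : ℝ) ^ 2 / (2 * 1))) * Real.exp (((1 : ℕ) : ℝ) * 0) * e ≤ 1 := by
    have : C ^ n₀ * (4 * Real.exp ((0 : ℝ) ^ 2 / (2 * 1))) * Real.exp (((1 : ℕ) : ℝ) * 0) * e = C ^ n₀ * 4 * e := by simp
    rw [this]; exact h3
  have hvac : Real.exp (((1 : ℕ) : ℝ) * 0) * ((1 : ℕ) : ℝ) * (4 * Real.exp ((0 : ℝ) ^ 2 / (2 * 1))) * e + (Real.exp (((1 : ℕ) : ℝ) * 0) - 1) ≤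
      Real.sqrt e ^ (1 : ℝ) := by
    have : Real.exp (((1 : ℕ) : ℝ) * 0) * ((1 : ℕ) : ℝ) * (4 * Real.exp ((0 : ℝ) ^ 2 / (2 * 1))) * e + (Real.exp (((1 : ℕ) : ℝ) * 0) - 1) =
        4 * e := by simp
    rw [this, Real.rpow_one]
    calc 4 * e = (4 * Real.sqrt e) * Real.sqrt e := by rw [mul_assoc, Real.mul_self_sqrt he.le]
      _ ≤ 1 * Real.sqrt e := by gcongr; linarith
      _ = Real.sqrt e := one_mul _
  have hreg' : (n₀ : ℝ) + 1 ≤ 1 / (8 * (1 : ℝ) ^ 2) * (81 / 100) * (1 : ℝ) ^ 2 * Real.log e⁻¹ ^ (2 * p - 1) := h1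
  exact ineq5144_locAct_blockDiag_of_struct (id : I → I) (1 : Matrix I I ℝ) (0 : I → ℝ) adj gevreyCutoff cube hp hC1 hC
    (fun x y hxy => Matrix.one_apply_ne hxy) Matrix.PosDef.one (m := 1) one_pos hΔm chi1_nonneg (c₀ := 1) one_pos (fun _ _ => le_rfl)
    (Λ := 1) one_pos (fun b _ => ⟨fun φ => φ b, fun φ => φ b, hlin b, hlin b, Or.inl fun _ => rfl, hΛ b, hΛ b⟩) (F := 0) le_rfl hF
    (fun Y hY => absurd hY (notMem_empty Y)) (KY := fun _ => 0) (fun Y hY => absurd hY (notMem_empty Y)) (K₁ := 0) le_rfl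
    (fun Y hY => absurd hY (notMem_empty Y)) (G := 1) hG he he1 (θ := Real.sqrt e) (β' := 1) hsqrt hreg' hpre
    (fun Y hY => absurd hY (notMem_empty Y)) hvac Λ X ht hL γ

end Literature.MathematicalPhysics.QuantumFieldTheory.BalabanImbrieJaffe1984to88.BIJ88Ineq5144LocatedSlots

end
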